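import Literature.GroupTheory.CombinatorialGroupTheory.FreeProductSurfaceSeparationLevels
import Literature.AnabelianGeometry.SemiGraphs.PSCUnrKerOfEdgeGenerators
import Literature.AnabelianGeometry.SemiGraphs.PSCSeparatingCoveringsTwoComponentAffineOrigin
import Literature.AnabelianGeometry.SemiGraphs.ProSigmaCompletionRestrict
import Literature.AnabelianGeometry.SemiGraphs.SurfaceTypeCoveringsToolkit
import HarnessLib

/-!
# [CombGC] Prop. 1.2, proof p. 9: the `Π^unr`-VERTICIAL separating coverings at the genuine two-component affine data (row F-2828 / P12-L01-U, door D1)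

Mochizuki, *A combinatorial version of the Grothendieck conjecture*, Tohoku Math. J. **59** (2007)
[CombGC], PROOF of Prop. 1.2, p. 9: "under the further assumption that `G` is sturdy … there exists a
finite étale `Π^unr_G`-covering `G' → G` whose restriction to the anabelioid `G_{v₂}` is trivial, but whose
restriction to the anabelioid `G_{v₁}` is nontrivial" [cite: MochizukiCombGC2007, Prop 1.2 proof p.9]; typed
LEVEL-WISE by abc-iut-w4-d081 as `PSCDatum.UnrVerticialSeparatingCoverings` (`PSCSeparatingCoverings.lean`,
row P12-L01-U; the `Π^unr` conjunct of FACT rows F-2828/F-2829/F-2830; universal closures refuted; instance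
forms so far only at one-vertex data and VACUOUSLY at non-sturdy two-component data).

PROOF-ONLY file (abc-iut-w5-d047 gen 7; door D1 step (iv) = 5/5 of abc-iut-f-166's programme, row
«D1-(iv) PROFINITE ASSEMBLY» of abc-iut-L3-lead β59): **the GENUINE STURDY instance** at the data of
two-component affine shape (abc-iut-f-164: `ι : Γ_{g,r} → Π` a profinite pro-`Σ` completion,
`Π_{v₀} = cl ι⟨a_i, b_i (i<g₀), c_j (s≤j)⟩`, `Π_{v₁} = cl ι⟨a_i, b_i (g₀≤i), c_j (j<s), ε⟩`, cusp groups
`cl ι⟨c_j⟩`, node group `cl ι⟨ε⟩`, genera `g₀`, `g − g₀`).  Route (abc-iut-w5-d195's notes on p462752):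
`Ker(Π ↠ Π^unr) = cl ι(K)`, `K = ⟨⟨ε, c_j⟩⟩` (`PSCUnrKerOfEdgeGenerators`); at an open normal `V` put
`N = ι⁻¹(V)`, `m = [Γ : N]`; the DISCRETE separating level `U' ⊴ N` of index dividing `ℓ^m` (`ℓ ∈ Σ`;
witness `a^m`, `a` the first handle of the ALIVE vertex — the alive clause carries no kernel, so the witness
is chosen in `Π_{v₁}` first) comes from `FreeProductSurfaceSeparationLevels.lean` (same vertex: abc-iut-f-166's
fibred twist in `Γ/K ≅ Γ_{g₀,0} ∗ Γ_{g−g₀,0}`; different vertices: projection to the alive factor) and is the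
trace of an open `U ⊴ V` since `V` is the pro-`Σ` completion of `N` (pattern of
`PSCSeparatingCoveringsSameVertex.lean`, here WITH the kernel on the killed side).

* `IsProSigmaCompletion.exists_open_unrSeparating_of_discrete` — the transfer `U' ⊴ ι⁻¹(V)` ↦ open `U ⊴ V`;
* `IsProSigmaCompletion.exists_open_unrSeparating_same / _cross` — the two `Π`-level clauses;
* `PSCDatum.unrVerticialSeparatingCoverings_of_twoComponentAffine` — **row P12-L01-U at EVERY two-component
  affine datum** (`V' := V`; sturdiness enters only through its own antecedent, via the genus pins).

A shape instance is consistency evidence for the typed schema, not the printed statement for all pointed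
stable curves (cell FOUNDATIONS rows 13–14).  0 definitions; nothing here takes a side on [IUTchIII] Cor. 3.12.
-/

noncomputable section

namespace Literature.AnabelianGeometry.SemiGraphs

open scoped Pointwise
open Literature.AnabelianGeometry.Anabelioids (IsSigmaInteger)
open Literature.GroupTheory.CombinatorialGroupTheory
open Monoid (Coprod)

/-! ### The transfer: discrete separating levels are traces of open ones -/

namespace SemiGraphOfAnabelioids.IsProSigmaCompletion

variable {Sigma : Set ℕ} {Γ : Type*} [Group Γ] {P : Type*} [Group P] [TopologicalSpace P]
  [IsTopologicalGroup P] [CompactSpace P] [TotallyDisconnectedSpace P] {ι : Γ →* P}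

/-- **Transfer of a separating level along a pro-`Σ` completion, kernel included.**  `V ⊴ Π` open,
`N = ι⁻¹(V)`, `U' ⊴ N` of `Σ`-integer index containing `(f₂ Hk f₂⁻¹ · K) ∩ N` and missing an element of
`f₁ Ha f₁⁻¹ ∩ N`: some open `U ≤ V`, normal in `V`, contains `(ι(f₂) cl ι(Hk) ι(f₂)⁻¹ · cl ι(K)) ∩ V` and
not `ι(f₁) cl ι(Ha) ι(f₁)⁻¹ ∩ V` (`V` is the pro-`Σ` completion of `N`). [cite: MochizukiCombGC2007, Prop 1.2 proof p.9] -/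
theorem exists_open_unrSeparating_of_discrete (hι : IsProSigmaCompletion Sigma ι)
    (Ha Hk K : Subgroup Γ) (V : Subgroup P) [V.Normal] (hVo : IsOpen (V : Set P)) (f₁ f₂ : Γ)
    (U' : Subgroup (V.comap ι)) [hU'n : U'.Normal] (hU'S : IsSigmaInteger Sigma U'.index)
    (hkill : ((ConjAct.toConjAct f₂ • Hk) ⊔ K) ⊓ V.comap ι ≤ U'.map (V.comap ι).subtype)
    (halive : ∃ x ∈ (ConjAct.toConjAct f₁ • Ha) ⊓ V.comap ι, x ∉ U'.map (V.comap ι).subtype) :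
    ∃ U : Subgroup P, IsOpen (U : Set P) ∧ U ≤ V ∧ (U.subgroupOf V).Normal ∧
      ((ConjAct.toConjAct (ι f₂) • (Hk.map ι).topologicalClosure) ⊔ (K.map ι).topologicalClosure) ⊓ V
          ≤ U ∧
      ¬ ((ConjAct.toConjAct (ι f₁) • (Ha.map ι).topologicalClosure) ⊓ V ≤ U) := by
  classical
  have hι' : IsProSigmaCompletion Sigma (ι.subgroupComap V) := restrict hι V hVo
  obtain ⟨U₀, hU₀o, hU₀c⟩ := exists_isOpen_comap_subgroupComap_eq hι V hVo U' hU'S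
  haveI hU₀n : U₀.Normal := normal_of_comap_normal hι' U₀ hU₀o (by rw [hU₀c]; exact hU'n)
  have hUo : IsOpen ((U₀.map V.subtype : Subgroup P) : Set P) := isOpen_map_subtype V hVo U₀ hU₀o
  -- dictionary between `U'.map N.subtype ≤ Γ` and `U₀.map V.subtype ≤ Π`
  have hdict : ∀ {z : Γ} (hz : z ∈ V.comap ι),
      ι z ∈ U₀.map V.subtype ↔ z ∈ U'.map (V.comap ι).subtype := by
    intro z hz
    constructor
    · intro h
      obtain ⟨u, hu, huz⟩ := Subgroup.mem_map.mp h
      have hu' : u = ι.subgroupComap V ⟨z, hz⟩ := Subtype.ext huz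
      rw [hu', ← Subgroup.mem_comap, hU₀c] at hu
      exact Subgroup.mem_map.mpr ⟨⟨z, hz⟩, hu, rfl⟩
    · intro h
      obtain ⟨u, hu, huz⟩ := Subgroup.mem_map.mp h
      rw [← hU₀c, Subgroup.mem_comap] at hu
      exact Subgroup.mem_map.mpr ⟨ι.subgroupComap V u, hu, congrArg ι (huz : (u : Γ) = z)⟩
  refine ⟨U₀.map V.subtype, hUo, Subgroup.map_subtype_le U₀, ?_, ?_, ?_⟩
  · rw [← Subgroup.comap_subtype, Subgroup.comap_map_eq_self_of_injective V.subtype_injective]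
    exact hU₀n
  · have hL : (ConjAct.toConjAct (ι f₂) • (Hk.map ι).topologicalClosure) ⊔ (K.map ι).topologicalClosure ≤
        ((((ConjAct.toConjAct f₂ • Hk) ⊔ K).map ι).topologicalClosure) := by
      rw [← topologicalClosure_conjAct_smul, ← map_toConjAct_smul, Subgroup.map_sup]
      exact sup_le (Subgroup.topologicalClosure_mono le_sup_left)
        (Subgroup.topologicalClosure_mono le_sup_right)
    refine (inf_le_inf_right V hL).trans ?_
    rw [topologicalClosure_map_inf_of_isOpen ι _ V hVo]
    refine Subgroup.topologicalClosure_minimal _ ?_ (Subgroup.isClosed_of_isOpen _ hUo)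
    rintro _ ⟨z, hz, rfl⟩
    exact (hdict hz.2).mpr (hkill hz)
  · rw [← topologicalClosure_conjAct_smul, ← map_toConjAct_smul, topologicalClosure_map_inf_of_isOpen
      ι _ V hVo]
    intro hle
    obtain ⟨x, hx, hxU⟩ := halive
    exact hxU ((hdict hx.2).mp (hle (Subgroup.le_topologicalClosure _ (Subgroup.mem_map_of_mem ι hx))))

omit [CompactSpace P] [TotallyDisconnectedSpace P] in
/-- **Representatives of a level vertex of the `Π^unr`-covering**: `γ = w·ι(f)` with `w ∈ V`, and the
vertex data seen from `ι(f)`. [cite: MochizukiCombGC2007, Def 1.1(ii) p.7] -/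
theorem exists_rep_unr (hι : IsProSigmaCompletion Sigma ι) (A Ker : Subgroup P) [hKn : Ker.Normal]
    (V : Subgroup P) [hVn : V.Normal] (hVo : IsOpen (V : Set P)) (γ : ConjAct P) :
    ∃ (f : Γ) (w : P), w ∈ V ∧
      ((γ • A) ⊔ Ker) ⊓ V =
        ConjAct.toConjAct w • (((ConjAct.toConjAct (ι f) • A) ⊔ Ker) ⊓ V) ∧
      (γ • A) ⊓ V = ConjAct.toConjAct w • ((ConjAct.toConjAct (ι f) • A) ⊓ V) ∧
      DoubleCoset.doubleCoset (ConjAct.ofConjAct γ) (V : Set P) ((A ⊔ Ker : Subgroup P) : Set P) =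
        DoubleCoset.doubleCoset (ι f) (V : Set P) ((A ⊔ Ker : Subgroup P) : Set P) := by
  obtain ⟨f, hf⟩ := exists_mem_coset hι V hVo (ConjAct.ofConjAct γ)
  have hw : ConjAct.ofConjAct γ * (ι f)⁻¹ ∈ V := by
    have h1 := hVn.conj_mem _ (V.inv_mem hf) (ConjAct.ofConjAct γ)
    simpa [mul_assoc] using h1
  have hγ : γ = ConjAct.toConjAct (ConjAct.ofConjAct γ * (ι f)⁻¹) * ConjAct.toConjAct (ι f) := by
    rw [← map_mul, inv_mul_cancel_right, ConjAct.toConjAct_ofConjAct]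
  refine ⟨f, ConjAct.ofConjAct γ * (ι f)⁻¹, hw, ?_, ?_, ?_⟩
  · rw [Subgroup.smul_inf, hVn.conjAct, Subgroup.smul_sup, hKn.conjAct, ← mul_smul, ← hγ]
  · rw [Subgroup.smul_inf, hVn.conjAct, ← mul_smul, ← hγ]
  · exact DoubleCoset.doubleCoset_eq_of_mem (DoubleCoset.mem_doubleCoset.mpr
      ⟨ConjAct.ofConjAct γ * (ι f)⁻¹, hw, 1, Subgroup.one_mem _, by group⟩)

omit [CompactSpace P] [TotallyDisconnectedSpace P] in
/-- **Distinct level vertices over one vertex, read in `Γ`.**  If `V ι(f₁) (cl ι(H) · cl ι(K)) ≠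
V ι(f₂) (cl ι(H) · cl ι(K))` then `f₁⁻¹ f₂ ∉ H·K·ι⁻¹(V)`. [cite: MochizukiCombGC2007, Def 1.1(ii) p.7] -/
theorem not_mem_mul_of_doubleCoset_ne (H K : Subgroup Γ) (V : Subgroup P) [hVn : V.Normal] {f₁ f₂ : Γ}
    (hne : DoubleCoset.doubleCoset (ι f₁) (V : Set P)
        ((((H.map ι).topologicalClosure ⊔ (K.map ι).topologicalClosure) : Subgroup P) : Set P) ≠
      DoubleCoset.doubleCoset (ι f₂) (V : Set P)
        ((((H.map ι).topologicalClosure ⊔ (K.map ι).topologicalClosure) : Subgroup P) : Set P)) :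
    f₁⁻¹ * f₂ ∉ (H : Set Γ) * (K : Set Γ) * (V.comap ι : Set Γ) := by
  intro hmem
  obtain ⟨_, ⟨h, hh, k, hk, rfl⟩, n, hn, heq⟩ := Set.mem_mul.mp hmem
  apply hne
  symm
  have hf₂ : f₂ = f₁ * (h * k * n) := by rw [heq, mul_inv_cancel_left]
  have hnV : ι n ∈ V := hn
  have hy : ι h * ι k ∈ ((H.map ι).topologicalClosure ⊔ (K.map ι).topologicalClosure : Subgroup P) :=
    Subgroup.mul_mem _
      (Subgroup.mem_sup_left (Subgroup.le_topologicalClosure _ (Subgroup.mem_map_of_mem ι hh)))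
      (Subgroup.mem_sup_right (Subgroup.le_topologicalClosure _ (Subgroup.mem_map_of_mem ι hk)))
  refine DoubleCoset.doubleCoset_eq_of_mem (DoubleCoset.mem_doubleCoset.mpr
    ⟨(ι f₁ * ι h * ι k) * ι n * (ι f₁ * ι h * ι k)⁻¹, hVn.conj_mem _ hnV _, ι h * ι k, hy, ?_⟩)
  rw [hf₂, map_mul, map_mul, map_mul]
  group

omit [TopologicalSpace P] [IsTopologicalGroup P] [CompactSpace P] [TotallyDisconnectedSpace P] in
/-- For `U ≤ V` normal in `V` and `t ∈ V`: `t U t⁻¹ = U` ("trivial over a vertex" does not depend on the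
representative of the level vertex). [cite: MochizukiCombGC2007, Def 1.1(ii) p.6] -/
theorem conjAct_smul_eq_of_subgroupOf_normal {U V : Subgroup P} (hUV : U ≤ V)
    [hn : (U.subgroupOf V).Normal] {t : P} (ht : t ∈ V) : ConjAct.toConjAct t • U = U := by
  have key : ∀ {s : P}, s ∈ V → ∀ {x : P}, x ∈ U → s * x * s⁻¹ ∈ U := by
    intro s hs x hx
    have h := hn.conj_mem ⟨x, hUV hx⟩ (Subgroup.mem_subgroupOf.mpr hx) ⟨s, hs⟩
    exact Subgroup.mem_subgroupOf.mp h
  ext x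
  rw [Subgroup.mem_smul_pointwise_iff_exists]
  constructor
  · rintro ⟨u, hu, rfl⟩
    rw [ConjAct.smul_def, ConjAct.ofConjAct_toConjAct]
    exact key ht hu
  · intro hx
    refine ⟨t⁻¹ * x * t⁻¹⁻¹, key (V.inv_mem ht) hx, ?_⟩
    rw [ConjAct.smul_def, ConjAct.ofConjAct_toConjAct]
    group

/-- **`Π`-level clause, same vertex**: `Pv = cl ι(H)`, `Ker = cl ι(K)`, `V ⊴ Π` open,
`V γ₁ (Pv·Ker) ≠ V γ₂ (Pv·Ker)` and a DISCRETE supplier for `f₁⁻¹ f₂ ∉ H·K·ι⁻¹(V)` give an open `U ≤ V`,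
normal in `V`, containing `(γ₂ Pv γ₂⁻¹ · Ker) ∩ V` and not `γ₁ Pv γ₁⁻¹ ∩ V`.
[cite: MochizukiCombGC2007, Prop 1.2 proof p.9] -/
theorem exists_open_unrSeparating_same (hι : IsProSigmaCompletion Sigma ι) (H K : Subgroup Γ)
    (Pv Ker : Subgroup P) [Ker.Normal] (hPv : Pv = (H.map ι).topologicalClosure)
    (hKer : Ker = (K.map ι).topologicalClosure) (V : Subgroup P) [V.Normal] (hVo : IsOpen (V : Set P))
    (γ₁ γ₂ : ConjAct P)
    (hne : DoubleCoset.doubleCoset (ConjAct.ofConjAct γ₁) (V : Set P) ((Pv ⊔ Ker : Subgroup P) : Set P) ≠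
      DoubleCoset.doubleCoset (ConjAct.ofConjAct γ₂) (V : Set P) ((Pv ⊔ Ker : Subgroup P) : Set P))
    (hdisc : ∀ f₁ f₂ : Γ, f₁⁻¹ * f₂ ∉ (H : Set Γ) * (K : Set Γ) * (V.comap ι : Set Γ) →
      ∃ U' : Subgroup (V.comap ι), U'.Normal ∧ IsSigmaInteger Sigma U'.index ∧
        ((ConjAct.toConjAct f₂ • H) ⊔ K) ⊓ V.comap ι ≤ U'.map (V.comap ι).subtype ∧
        ∃ x ∈ (ConjAct.toConjAct f₁ • H) ⊓ V.comap ι, x ∉ U'.map (V.comap ι).subtype) :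
    ∃ U : Subgroup P, IsOpen (U : Set P) ∧ U ≤ V ∧ (U.subgroupOf V).Normal ∧
      (γ₂ • Pv ⊔ Ker) ⊓ V ≤ U ∧ ¬ ((γ₁ • Pv) ⊓ V ≤ U) := by
  obtain ⟨f₁, w₁, hw₁, -, hA₁, hdc₁⟩ := exists_rep_unr hι Pv Ker V hVo γ₁
  obtain ⟨f₂, w₂, hw₂, hA₂, -, hdc₂⟩ := exists_rep_unr hι Pv Ker V hVo γ₂
  have hne' : f₁⁻¹ * f₂ ∉ (H : Set Γ) * (K : Set Γ) * (V.comap ι : Set Γ) := by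
    refine not_mem_mul_of_doubleCoset_ne H K V ?_
    rw [← hPv, ← hKer, ← hdc₁, ← hdc₂]
    exact hne
  obtain ⟨U', hU'n, hU'S, hkill, halive⟩ := hdisc f₁ f₂ hne'
  haveI := hU'n
  obtain ⟨U, hUo, hUV, hUn, hk, ha⟩ :=
    exists_open_unrSeparating_of_discrete hι H H K V hVo f₁ f₂ U' hU'S hkill halive
  haveI := hUn
  refine ⟨U, hUo, hUV, hUn, ?_, ?_⟩
  · rw [hA₂, ← conjAct_smul_eq_of_subgroupOf_normal hUV hw₂, Subgroup.pointwise_smul_le_pointwise_smul_iff,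
      hPv, hKer]
    exact hk
  · rw [hA₁, ← conjAct_smul_eq_of_subgroupOf_normal hUV hw₁, Subgroup.pointwise_smul_le_pointwise_smul_iff,
      hPv]
    exact ha

/-- **`Π`-level clause, two different vertices**: `Pa = cl ι(Ha)` alive, `Pk = cl ι(Hk)` killed,
`Ker = cl ι(K)`, a DISCRETE supplier for ALL `f₁, f₂`; conclusion as in the same-vertex clause.
[cite: MochizukiCombGC2007, Prop 1.2 proof p.9] -/
theorem exists_open_unrSeparating_cross (hι : IsProSigmaCompletion Sigma ι) (Ha Hk K : Subgroup Γ)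
    (Pa Pk Ker : Subgroup P) [Ker.Normal] (hPa : Pa = (Ha.map ι).topologicalClosure)
    (hPk : Pk = (Hk.map ι).topologicalClosure) (hKer : Ker = (K.map ι).topologicalClosure)
    (V : Subgroup P) [V.Normal] (hVo : IsOpen (V : Set P)) (γ₁ γ₂ : ConjAct P)
    (hdisc : ∀ f₁ f₂ : Γ, ∃ U' : Subgroup (V.comap ι), U'.Normal ∧ IsSigmaInteger Sigma U'.index ∧
        ((ConjAct.toConjAct f₂ • Hk) ⊔ K) ⊓ V.comap ι ≤ U'.map (V.comap ι).subtype ∧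
        ∃ x ∈ (ConjAct.toConjAct f₁ • Ha) ⊓ V.comap ι, x ∉ U'.map (V.comap ι).subtype) :
    ∃ U : Subgroup P, IsOpen (U : Set P) ∧ U ≤ V ∧ (U.subgroupOf V).Normal ∧
      (γ₂ • Pk ⊔ Ker) ⊓ V ≤ U ∧ ¬ ((γ₁ • Pa) ⊓ V ≤ U) := by
  obtain ⟨f₁, w₁, hw₁, -, hA₁, -⟩ := exists_rep_unr hι Pa Ker V hVo γ₁
  obtain ⟨f₂, w₂, hw₂, hA₂, -, -⟩ := exists_rep_unr hι Pk Ker V hVo γ₂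
  obtain ⟨U', hU'n, hU'S, hkill, halive⟩ := hdisc f₁ f₂
  haveI := hU'n
  obtain ⟨U, hUo, hUV, hUn, hk, ha⟩ :=
    exists_open_unrSeparating_of_discrete hι Ha Hk K V hVo f₁ f₂ U' hU'S hkill halive
  haveI := hUn
  refine ⟨U, hUo, hUV, hUn, ?_, ?_⟩
  · rw [hA₂, ← conjAct_smul_eq_of_subgroupOf_normal hUV hw₂, Subgroup.pointwise_smul_le_pointwise_smul_iff,
      hPk, hKer]
    exact hk
  · rw [hA₁, ← conjAct_smul_eq_of_subgroupOf_normal hUV hw₁, Subgroup.pointwise_smul_le_pointwise_smul_iff,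
      hPa]
    exact ha

end SemiGraphOfAnabelioids.IsProSigmaCompletion

/-! ### Row P12-L01-U at the two-component affine data -/

namespace PSCDatum

open SemiGraphOfAnabelioids (IsProSigmaCompletion)
open SemiGraphOfAnabelioids.IsProSigmaCompletion (exists_open_unrSeparating_same
  exists_open_unrSeparating_cross finiteIndex_comap)
open Literature.GroupTheory.CombinatorialGroupTheory.PuncturedSurfaceGroup (a b c cuspInertia
  exists_coprod_symm_pinned map_mk_closure_v0_eq_range map_mk_closure_v1_eq_range
  exists_handleCharacter_pow_ne_one)

variable {P : Type} [Group P] [TopologicalSpace P] [IsTopologicalGroup P]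
variable [CompactSpace P] [TotallyDisconnectedSpace P] {Sigma : Set ℕ} {g r : ℕ}

/-- **Row P12-L01-U (`UnrVerticialSeparatingCoverings`, the `Π^unr` conjunct of F-2829 / row F-2828) at the
genuine two-component affine data**, sturdy or not (`V' := V`): distinct vertices
`(v₁', Vγ₁(Π_{v₁'}·Ker)) ≠ (v₂', Vγ₂(Π_{v₂'}·Ker))` of the `Π^unr`-covering `G_V` are separated by an open
`U ≤ V`, normal in `V`, with `(γ₂Π_{v₂'}γ₂⁻¹ · Ker) ∩ V ≤ U` and `γ₁Π_{v₁'}γ₁⁻¹ ∩ V ⊄ U`.  Sturdiness (the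
antecedent) enters through the genus pins; witness `a^{[Γ:ι⁻¹V]}` for the first handle `a` of the alive
vertex; fibred twist (same vertex) resp. projection (different vertices) in `Γ/⟨⟨c_j, ε⟩⟩ ≅ Γ_{g₀,0} ∗ Γ_{g−g₀,0}`.
[cite: MochizukiCombGC2007, Prop 1.2 proof p.9] -/
theorem unrVerticialSeparatingCoverings_of_twoComponentAffine (hne : Sigma.Nonempty)
    (hprime : ∀ p ∈ Sigma, p.Prime) (ι : PuncturedSurfaceGroup g r →* P)
    (hι : IsProSigmaCompletion Sigma ι) (G : PSCDatum P) {g₀ s : ℕ} (e : G.graph.C ≃ Fin r)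
    (hC : ∀ c', G.cuspGp c' = ((cuspInertia (g := g) (e c')).map ι).topologicalClosure)
    (n₀ : G.graph.N) (hN : ∀ n, n = n₀)
    (v₀ v₁ : G.graph.V) (hV : ∀ w, w = v₀ ∨ w = v₁) (ε : PuncturedSurfaceGroup g r)
    (hε : ε = ((List.finRange r).map fun j : Fin r =>
          if s ≤ (j : ℕ) then PuncturedSurfaceGroup.c (g := g) j else 1).prod *
        ((List.finRange g).map fun i : Fin g => if (i : ℕ) < g₀ then
          PuncturedSurfaceGroup.a (r := r) i * PuncturedSurfaceGroup.b i *
            (PuncturedSurfaceGroup.a i)⁻¹ * (PuncturedSurfaceGroup.b i)⁻¹ else 1).prod)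
    (hV₀ : G.vertGp v₀ = ((Subgroup.closure {x : PuncturedSurfaceGroup g r |
        (∃ i : Fin g, (i : ℕ) < g₀ ∧ (x = PuncturedSurfaceGroup.a i ∨ x = PuncturedSurfaceGroup.b i)) ∨
        ∃ j : Fin r, s ≤ (j : ℕ) ∧ x = PuncturedSurfaceGroup.c j}).map ι).topologicalClosure)
    (hV₁ : G.vertGp v₁ = ((Subgroup.closure {x : PuncturedSurfaceGroup g r |
        (∃ i : Fin g, g₀ ≤ (i : ℕ) ∧ (x = PuncturedSurfaceGroup.a i ∨ x = PuncturedSurfaceGroup.b i)) ∨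
        (∃ j : Fin r, (j : ℕ) < s ∧ x = PuncturedSurfaceGroup.c j) ∨ x = ε}).map ι).topologicalClosure)
    (hE : G.nodeGp n₀ = ((Subgroup.zpowers ε).map ι).topologicalClosure)
    (hgen₀ : G.genus v₀ = g₀) (hgen₁ : G.genus v₁ = g - g₀) :
    G.UnrVerticialSeparatingCoverings := by
  classical
  intro hst V hVn hVo
  haveI := hVn
  have hg₀ : 2 ≤ g₀ := hgen₀ ▸ hst v₀
  have hg₁' : 2 ≤ g - g₀ := hgen₁ ▸ hst v₁
  obtain ⟨g₁, rfl⟩ : ∃ g₁, g = g₀ + g₁ := ⟨g - g₀, by omega⟩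
  have hg₁ : 2 ≤ g₁ := by omega
  obtain ⟨ℓ, hℓS⟩ := hne
  have hℓ : ℓ.Prime := hprime ℓ hℓS
  set K : Subgroup (PuncturedSurfaceGroup (g₀ + g₁) r) :=
    Subgroup.normalClosure ({ε} ∪ Set.range (c : Fin r → PuncturedSurfaceGroup (g₀ + g₁) r)) with hKdef
  have hcK : ∀ j, c j ∈ K := fun j => Subgroup.subset_normalClosure (Or.inr ⟨j, rfl⟩)
  have hεK : ε ∈ K := Subgroup.subset_normalClosure (Or.inl rfl)
  have hKer : G.unrKer = (K.map ι).topologicalClosure := by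
    let xs : G.graph.N ⊕ G.graph.C → PuncturedSurfaceGroup (g₀ + g₁) r :=
      Sum.elim (fun _ => ε) fun c' => c (e c')
    have hx : ∀ e', G.edgeGp e' = ((Subgroup.zpowers (xs e')).map ι).topologicalClosure := by
      rintro (n | c')
      · change G.nodeGp n = ((Subgroup.zpowers ε).map ι).topologicalClosure
        rw [hN n, hE]
      · exact hC c'
    have hrange : Set.range xs = {ε} ∪ Set.range (c : Fin r → PuncturedSurfaceGroup (g₀ + g₁) r) := by
      ext x
      simp only [xs, Set.mem_range, Set.mem_union, Set.mem_singleton_iff, Sum.exists, Sum.elim_inl,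
        Sum.elim_inr]
      constructor
      · rintro (⟨_, rfl⟩ | ⟨c', rfl⟩)
        · exact Or.inl rfl
        · exact Or.inr ⟨e c', rfl⟩
      · rintro (rfl | ⟨j, rfl⟩)
        · exact Or.inl ⟨n₀, rfl⟩
        · exact Or.inr ⟨e.symm j, by rw [Equiv.apply_symm_apply]⟩
    rw [G.unrKer_eq_topologicalClosure_map_normalClosure hι.dense xs hx, hrange]
  -- the Tietze data and the images of the two vertex generating sets
  obtain ⟨ē, ē', h1, h2, h3, h4⟩ := exists_coprod_symm_pinned g₀ g₁ r s ε hε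
  set H₀ : Subgroup (PuncturedSurfaceGroup (g₀ + g₁) r) := Subgroup.closure {x |
      (∃ i : Fin (g₀ + g₁), (i : ℕ) < g₀ ∧ (x = a i ∨ x = b i)) ∨
        ∃ j : Fin r, s ≤ (j : ℕ) ∧ x = c j} with hH₀def
  set H₁ : Subgroup (PuncturedSurfaceGroup (g₀ + g₁) r) := Subgroup.closure {x |
      (∃ i : Fin (g₀ + g₁), g₀ ≤ (i : ℕ) ∧ (x = a i ∨ x = b i)) ∨
        (∃ j : Fin r, (j : ℕ) < s ∧ x = c j) ∨ x = ε} with hH₁def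
  have hH₀A : H₀.map (QuotientGroup.mk' K) = (ē.toMonoidHom.comp Coprod.inl).range :=
    map_mk_closure_v0_eq_range s K hcK _ fun i bit => h1 i bit
  have hH₁C : H₁.map (QuotientGroup.mk' K) = (ē.toMonoidHom.comp Coprod.inr).range :=
    map_mk_closure_v1_eq_range s K hcK hεK _ fun j bit => h2 j bit
  have hH₁A' : H₁.map (QuotientGroup.mk' K) = (ē'.toMonoidHom.comp Coprod.inl).range :=
    map_mk_closure_v1_eq_range s K hcK hεK _ fun j bit => h3 j bit
  have hH₀C' : H₀.map (QuotientGroup.mk' K) = (ē'.toMonoidHom.comp Coprod.inr).range :=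
    map_mk_closure_v0_eq_range s K hcK _ fun i bit => h4 i bit
  -- the level `N = ι⁻¹(V)`, `m = [Γ : N]`, the modulus `n = ℓ^m ∤ m`
  haveI hNfi : (V.comap ι).FiniteIndex := finiteIndex_comap hι V hVo
  have hm : 0 < (V.comap ι).index := Nat.pos_of_ne_zero Subgroup.FiniteIndex.index_ne_zero
  haveI : NeZero (ℓ ^ (V.comap ι).index) := ⟨(pow_pos hℓ.pos _).ne'⟩
  have hnm : ¬ ℓ ^ (V.comap ι).index ∣ (V.comap ι).index := fun h =>
    absurd (Nat.le_of_dvd hm h) (not_le.mpr (Nat.lt_pow_self hℓ.one_lt))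
  -- witnesses: `a^m` for the first handle of each component, and characters seeing them
  obtain ⟨ψ₀, hψ₀, hcard⟩ := exists_handleCharacter_pow_ne_one (g := g₀) (by omega) (V.comap ι).index
    (ℓ ^ (V.comap ι).index) hnm
  obtain ⟨ψ₁, hψ₁, -⟩ := exists_handleCharacter_pow_ne_one (g := g₁) (by omega) (V.comap ι).index
    (ℓ ^ (V.comap ι).index) hnm
  have ha₀N : a (r := r) (Fin.castAdd g₁ ⟨0, by omega⟩) ^ (V.comap ι).index ∈ V.comap ι :=
    (V.comap ι).pow_index_mem _
  have ha₁N : a (r := r) (Fin.natAdd g₀ ⟨0, by omega⟩) ^ (V.comap ι).index ∈ V.comap ι :=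
    (V.comap ι).pow_index_mem _
  have ha₀H : a (r := r) (Fin.castAdd g₁ ⟨0, by omega⟩) ^ (V.comap ι).index ∈ H₀ :=
    H₀.pow_mem (Subgroup.subset_closure (Or.inl ⟨Fin.castAdd g₁ ⟨0, by omega⟩, by simp; omega,
      Or.inl rfl⟩)) _
  have ha₁H : a (r := r) (Fin.natAdd g₀ ⟨0, by omega⟩) ^ (V.comap ι).index ∈ H₁ :=
    H₁.pow_mem (Subgroup.subset_closure (Or.inl ⟨Fin.natAdd g₀ ⟨0, by omega⟩, by simp, Or.inl rfl⟩)) _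
  have hα₀ : QuotientGroup.mk' K (a (r := r) (Fin.castAdd g₁ ⟨0, by omega⟩) ^ (V.comap ι).index) =
      ē (Coprod.inl (a ⟨0, by omega⟩ ^ (V.comap ι).index)) := by
    rw [map_pow, map_pow, map_pow, QuotientGroup.mk'_apply]
    exact congrArg (· ^ (V.comap ι).index) (h1 ⟨0, by omega⟩ false).symm
  have hα₁ : QuotientGroup.mk' K (a (r := r) (Fin.natAdd g₀ ⟨0, by omega⟩) ^ (V.comap ι).index) =
      ē' (Coprod.inl (a ⟨0, by omega⟩ ^ (V.comap ι).index)) := by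
    rw [map_pow, map_pow, map_pow, QuotientGroup.mk'_apply]
    exact congrArg (· ^ (V.comap ι).index) (h3 ⟨0, by omega⟩ false).symm
  -- bookkeeping shared by the four cases
  have hS : ∀ U' : Subgroup (V.comap ι), U'.index ∣ Nat.card (Multiplicative (ZMod (ℓ ^ (V.comap ι).index))) →
      U'.FiniteIndex → IsSigmaInteger Sigma U'.index := fun U' h hf =>
    ⟨Nat.pos_of_ne_zero hf.index_ne_zero, fun _ hp hpn =>
      ((Nat.prime_dvd_prime_iff_eq hp hℓ).mp (hp.dvd_of_dvd_pow (hpn.trans (hcard ▸ h)))) ▸ hℓS⟩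
  have hwit : ∀ (f : PuncturedSurfaceGroup (g₀ + g₁) r) (H : Subgroup (PuncturedSurfaceGroup (g₀ + g₁) r))
      (x : PuncturedSurfaceGroup (g₀ + g₁) r), x ∈ H → x ∈ V.comap ι →
      f * x * f⁻¹ ∈ (ConjAct.toConjAct f • H) ⊓ V.comap ι := fun f H x hx hxN => by
    refine ⟨?_, (inferInstance : (V.comap ι).Normal).conj_mem x hxN f⟩
    have hfx : f * x * f⁻¹ = ConjAct.toConjAct f • x := by
      rw [ConjAct.smul_def, ConjAct.ofConjAct_toConjAct]
    rw [hfx]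
    exact Subgroup.smul_mem_pointwise_smul _ _ _ hx
  refine ⟨V, hVn, hVo, le_rfl, fun w₁ w₂ γ₁ γ₂ hdc => ?_⟩
  rcases hV w₁ with rfl | rfl <;> rcases hV w₂ with rfl | rfl
  · -- `v₀ / v₀`: same factor, Tietze orientation `ē`
    refine exists_open_unrSeparating_same hι H₀ K _ _ hV₀ hKer V hVo γ₁ γ₂
      (hdc.resolve_left fun h => h rfl) fun f₁ f₂ hf => ?_
    obtain ⟨U', hU'n, hidx, hfi, hnot, hle⟩ :=
      exists_normal_separating_sameFactor K ē H₀ hH₀A (V.comap ι) ψ₀ ha₀N hα₀ hψ₀ hf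
    exact ⟨U', hU'n, hS U' hidx hfi, hle, _, hwit f₁ H₀ _ ha₀H ha₀N, hnot⟩
  · -- alive `v₀`, killed `v₁`: projection to the first factor of `ē`
    refine exists_open_unrSeparating_cross hι H₀ H₁ K _ _ _ hV₀ hV₁ hKer V hVo γ₁ γ₂ fun f₁ f₂ => ?_
    obtain ⟨U', hU'n, hidx, hfi, hnot, hle⟩ :=
      exists_normal_separating_crossFactor K ē H₁ hH₁C (V.comap ι) ψ₀ hα₀ hψ₀ f₁ f₂
    exact ⟨U', hU'n, hS U' hidx hfi, hle, _, hwit f₁ H₀ _ ha₀H ha₀N, hnot⟩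
  · -- alive `v₁`, killed `v₀`: projection to the first factor of `ē'`
    refine exists_open_unrSeparating_cross hι H₁ H₀ K _ _ _ hV₁ hV₀ hKer V hVo γ₁ γ₂ fun f₁ f₂ => ?_
    obtain ⟨U', hU'n, hidx, hfi, hnot, hle⟩ :=
      exists_normal_separating_crossFactor K ē' H₀ hH₀C' (V.comap ι) ψ₁ hα₁ hψ₁ f₁ f₂
    exact ⟨U', hU'n, hS U' hidx hfi, hle, _, hwit f₁ H₁ _ ha₁H ha₁N, hnot⟩
  · -- `v₁ / v₁`: same factor, swapped orientation `ē'`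
    refine exists_open_unrSeparating_same hι H₁ K _ _ hV₁ hKer V hVo γ₁ γ₂
      (hdc.resolve_left fun h => h rfl) fun f₁ f₂ hf => ?_
    obtain ⟨U', hU'n, hidx, hfi, hnot, hle⟩ :=
      exists_normal_separating_sameFactor K ē' H₁ hH₁A' (V.comap ι) ψ₁ ha₁N hα₁ hψ₁ hf
    exact ⟨U', hU'n, hS U' hidx hfi, hle, _, hwit f₁ H₁ _ ha₁H ha₁N, hnot⟩

end PSCDatum

end Literature.AnabelianGeometry.SemiGraphs

end
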